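import Summits.QuantumFields.YangMills.Theorems.ColdStartUniversalityLatticeLangevinLipschitzFunctionalInequalities
import Literature.MathematicalPhysics.QuantumFieldTheory.LatticeYangMillsBakryEmery
import HarnessLib

/-!
# Route `ColdStartUniversality` (fixed-cut-off package): SHEN–ZHU–ZHU'S THEOREM 1.4 / COROLLARY 4.5 FOR `SU(2)` IN `d = 3` IS A THEOREM OF THE TREE —
# the named fact `shenZhuZhu_functionalInequalities 3 2` discharged, with the sharp window `|β| < 1/24`

Helper file (seat `ym-line-csu-p1`, g38; `--supports stmt-QuantumFields-24809`).  The Literature files `ShenZhuZhuLogSobolev` /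
`LatticeYangMillsBakryEmery` type Shen–Zhu–Zhu's log-Sobolev and Poincaré inequalities (CMP 400 (2023), Theorem 1.4 = Corollary 4.5,
(1.9)–(1.10) = (4.12)–(4.13)) for EVERY infinite-volume limit point of the torus `SU(N)` Wilson states, in Lipschitz form, as the NAMED FACTS
`shenZhuZhu_functionalInequalities d N` and `SZZFunctionalInequalitiesWith d N β K` (conclusion shape of `shenZhuZhu_bakryEmery_transfer`),
"not proved in the tree: the general Bakry–Émery criterion on a compact Riemannian manifold is absent".  For `SU(2)`, `d = 3` the seat's
fixed-cut-off Bakry–Émery package (g25 Poincaré, g26 log-Sobolev, g38 Lipschitz form `…LipschitzFunctionalInequalities`) supplies exactly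
that criterion on every torus, uniformly in the volume; this file performs the passage to infinite-volume limit points:
* `SZZFunctionalInequalitiesWith.mono_const` — monotonicity of the conclusion shape in the constant;
* `eventually_injOn_torusEdge'` — a finite set of edges of `ℤ³` projects injectively to all large tori;
* ★★★ `szzFunctionalInequalitiesWith_su2_of_hessBound` — a frame-Hessian bound `K₀ < 2` on EVERY torus at tree coupling `2β` gives
  `SZZFunctionalInequalitiesWith 3 2 β (1 − K₀/2)`: LSI `Ent_μ(F²) ≤ (2/K)Σ_e L_e²` AND Poincaré `Var_μ(F) ≤ (1/K)Σ_e L_e²` for every tight limit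
  `μ`, every smooth cylinder function `F = f((U_e)_(e∈Λ))` that is `L_e`-Lipschitz in the link `e` (torus inequalities for the pulled-back
  cylinder function, whose link-Lipschitz profile on a large torus is `(L_e)` transported by the injective projection; weak limit along the
  subsequence of tori for the bounded continuous cylinder functions `F`, `F²`, `F² log F²`);
* ★★★ `szzFunctionalInequalitiesWith_su2_sharp` — with the tree's Hessian count (`wilson_hessBound`, `K₀ = 24|β'|`, `β' = 2β`): for every
  `|β| < 1/24`, `SZZFunctionalInequalitiesWith 3 2 β (1 − 24|β|)` — the venture `YMGap`'s sharp window `|β| < 1/(8d)` with BOTH clauses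
  (its kernel theorem `sharp_poincare_clause` had the variance clause only), for `SU(2)`, `d = 3`;
* ★★★ `shenZhuZhu_functionalInequalities_su2_d3 : shenZhuZhu_functionalInequalities 3 2` — THE NAMED FACT (Shen–Zhu–Zhu Theorem 1.4 in the
  tree's Lipschitz form, printed window `|β| < 1/32`, printed constant `K_S = 1 − 32|β| ≤ 1 − 24|β|`) for `SU(2)` lattice Yang–Mills in three
  dimensions, now UNCONDITIONAL.
THEOREMS ONLY, no definition, no sorry.  HONEST FRAMING: a STRONG-coupling statement (`|β| < 1/24` in 't Hooft units) about lattice Yang–Mills at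
fixed lattice spacing; it says nothing at weak coupling / in the continuum limit, nothing `K`-uniform along the route's scaling `β'_K → ∞`
(`UniformColdStartMixing`, 24809, ASIDE, not restated); no crux, rung or summit statement is proved; the Yang–Mills mass gap is NOT proved.
-/

set_option autoImplicit false

noncomputable section

namespace Summit.QuantumFields.YangMills.Theorems.ColdStartUniversality

open MeasureTheory ProbabilityTheory Finset Filter Set Metric
open scoped BigOperators NNReal ENNReal Topology Matrix.Norms.Frobenius ContDiff
open Literature.Probability.Process Literature.MathematicalPhysics.QuantumFieldTheory
open Literature.MathematicalPhysics.QuantumLattice (fundamentalRep fundamentalLatticeRep continuous_fundamentalRep fundamentalRep_apply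
  torusEdge torusLift toTorusObservable toTorusObservable_apply infiniteVolumeLimitPoints IsInfiniteVolumeLimitAlong IsCylinder LGConfig)

/-! ## §1. Bookkeeping: monotonicity in the constant; injectivity of the torus projection on a finite edge set -/

/-- **Monotonicity of Shen–Zhu–Zhu's conclusion in the constant**: `SZZFunctionalInequalitiesWith d N β K` with `0 < K' ≤ K` implies the same
with `K'` (both right-hand sides are `c/K · Σ_e L_e²` with `Σ_e L_e² ≥ 0`). [cite: ShenZhuZhu2022, §4 Corollary 4.5 (4.12)–(4.13)] -/
theorem SZZFunctionalInequalitiesWith.mono_const {d N : ℕ} {β K K' : ℝ} (h : SZZFunctionalInequalitiesWith d N β K) (hK' : 0 < K')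
    (hle : K' ≤ K) : SZZFunctionalInequalitiesWith d N β K' := by
  intro μ hμ Λ f L hf hL hLip
  obtain ⟨h1, h2⟩ := h μ hμ Λ f L hf hL hLip
  have hS : 0 ≤ ∑ e, L e ^ 2 := Finset.sum_nonneg fun e _ => sq_nonneg _
  have h2K : 2 / K ≤ 2 / K' := div_le_div_of_nonneg_left (by norm_num) hK' hle
  have h1K : 1 / K ≤ 1 / K' := div_le_div_of_nonneg_left (by norm_num) hK' hle
  exact ⟨h1.trans (mul_le_mul_of_nonneg_right h2K hS), h2.trans (mul_le_mul_of_nonneg_right h1K hS)⟩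

/-- Two distinct edges of `ℤ^d` have distinct images on all large tori.
-- adapted from Summits/Ventures/YMGap/Thresholds/SharpPoincare.lean (`eventually_torusEdge_ne`). [folklore] -/
theorem eventually_torusEdge_ne' {d : ℕ} {e e' : Literature.MathematicalPhysics.QuantumLattice.ZdEdge d} (h : e ≠ e') :
    ∀ᶠ L : ℕ in atTop, torusEdge (d := d) L e ≠ torusEdge L e' := by
  by_cases h2 : e.2 = e'.2
  · have h1 : e.1 ≠ e'.1 := fun h1 => h (Prod.ext h1 h2)
    obtain ⟨i, hi⟩ : ∃ i, e.1 i ≠ e'.1 i := by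
      by_contra hc; push Not at hc; exact h1 (funext hc)
    refine (eventually_gt_atTop (e.1 i - e'.1 i).natAbs).mono fun L hL hEq => ?_
    have hc : (Literature.Probability.LatticeModels.Torus.proj L e.1) i =
        (Literature.Probability.LatticeModels.Torus.proj L e'.1) i := by
      have := congrArg Prod.fst hEq
      simp only [torusEdge] at this
      rw [this]
    simp only [Literature.Probability.LatticeModels.Torus.proj_apply] at hc
    rw [ZMod.intCast_eq_intCast_iff_dvd_sub] at hc
    have hne : e'.1 i - e.1 i ≠ 0 := sub_ne_zero.2 (Ne.symm hi)
    have hle := Int.natAbs_le_of_dvd_ne_zero hc hne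
    rw [Int.natAbs_natCast, ← Int.natAbs_neg, neg_sub] at hle
    omega
  · exact Eventually.of_forall fun L hEq => h2 (by simpa [torusEdge] using congrArg Prod.snd hEq)

/-- A finite edge set of `ℤ^d` projects injectively to all large tori.
-- adapted from Summits/Ventures/YMGap/Thresholds/SharpPoincare.lean (`eventually_injOn_torusEdge`). [folklore] -/
theorem eventually_injOn_torusEdge' {d : ℕ} (Λ : Finset (Literature.MathematicalPhysics.QuantumLattice.ZdEdge d)) :
    ∀ᶠ L : ℕ in atTop, Set.InjOn (torusEdge (d := d) L) ↑Λ := by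
  have h : ∀ᶠ L : ℕ in atTop, ∀ p ∈ Λ ×ˢ Λ, p.1 ≠ p.2 → torusEdge (d := d) L p.1 ≠ torusEdge L p.2 := by
    refine (Finset.eventually_all (Λ ×ˢ Λ)).2 fun p _ => ?_
    by_cases hp : p.1 = p.2
    · exact Eventually.of_forall fun L hne => absurd hp hne
    · exact (eventually_torusEdge_ne' hp).mono fun L hL _ => hL
  refine h.mono fun L hL e he e' he' hEq => ?_
  by_contra hne
  exact hL (e, e') (Finset.mk_mem_product he he') hne hEq

/-! ## §2. From a frame-Hessian bound on every torus to Shen–Zhu–Zhu's Corollary 4.5 for limit points -/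

/-- ★★★ **Shen–Zhu–Zhu's Corollary 4.5 (log-Sobolev AND Poincaré, Lipschitz form) for `SU(2)`, `d = 3`, from a frame-Hessian bound on every
torus.**  If on every torus `(ℤ/L)³` the frame Hessian of the plaquette function at tree coupling `β' = 2β` is bounded by `K₀ < 2` times the
carré du champ (hypothesis `hHess` of the g25/g26 Bakry–Émery files), then `SZZFunctionalInequalitiesWith 3 2 β (1 − K₀/2)`: for every
infinite-volume limit point `μ` of the torus Wilson states at tree coupling `2β`, every finite `Λ ⊆ E⁺(ℤ³)`, every smooth `f` of the link
matrices over `Λ` that is `L_e`-Lipschitz in the link `e` (Frobenius distance): `Ent_μ(F²) ≤ (2/(1 − K₀/2))·Σ_e L_e²` and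
`Var_μ(F) ≤ (1/(1 − K₀/2))·Σ_e L_e²`, `F = f((U_e)_(e∈Λ))`.  (Torus: `wilson_variance/entropy_le_of_hessBound_of_linkLipschitz` for the pulled-back
cylinder function on every torus large enough that `Λ` projects injectively; then the weak limit along the subsequence of tori.)
[cite: ShenZhuZhu2022, §4 Corollary 4.4 (4.11) and Corollary 4.5 (4.12)–(4.13)] -/
theorem szzFunctionalInequalitiesWith_su2_of_hessBound (β K₀ : ℝ) (hK : K₀ < 2)
    (hHess : ∀ (L : ℕ) [NeZero L], (∀ (V : (GaugeConfig 3 L (Matrix.specialUnitaryGroup (Fin 2) ℂ))) (Λ : (Edge 3 L × Fin (fundamentalLatticeRep 2).N × Fin (fundamentalLatticeRep 2).N × Bool → ℝ) →L[ℝ] ℝ),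
      ∑ n : Edge 3 L × NoiseIdx (fundamentalLatticeRep 2).N, ∑ m : Edge 3 L × NoiseIdx (fundamentalLatticeRep 2).N,
        Λ ((fun q : Edge 3 L × Fin (fundamentalLatticeRep 2).N × Fin (fundamentalLatticeRep 2).N × Bool => if n.1 = q.1 then (fun z : ℂ => if q.2.2.2 then z.im else z.re) (((Real.sqrt 2 : ℂ) • ((fundamentalLatticeRep 2).lieProj (noiseDir n.2) * (fun (ee : Edge 3 L) => Matrix.of fun (i j : Fin (fundamentalLatticeRep 2).N) => (((fun (V : GaugeConfig 3 L (Matrix.specialUnitaryGroup (Fin 2) ℂ)) (q : Edge 3 L × Fin (fundamentalLatticeRep 2).N × Fin (fundamentalLatticeRep 2).N × Bool) => (fun z : ℂ => if q.2.2.2 then z.im else z.re) ((fundamentalRep (Fin 2) (V q.1) : Matrix (Fin 2) (Fin 2) ℂ) q.2.1 q.2.2.1)) V (ee, i, j, false) : ℝ) : ℂ) + (((fun (V : GaugeConfig 3 L (Matrix.specialUnitaryGroup (Fin 2) ℂ)) (q : Edge 3 L × Fin (fundamentalLatticeRep 2).N × Fin (fundamentalLatticeRep 2).N × Bool) => (fun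 z : ℂ => if q.2.2.2 then z.im else z.re) ((fundamentalRep (Fin 2) (V q.1) : Matrix (Fin 2) (Fin 2) ℂ) q.2.1 q.2.2.1)) V (ee, i, j, true) : ℝ) : ℂ) * Complex.I) q.1)) q.2.1 q.2.2.1) else 0)) * Λ ((fun q : Edge 3 L × Fin (fundamentalLatticeRep 2).N × Fin (fundamentalLatticeRep 2).N × Bool => if m.1 = q.1 then (fun z : ℂ => if q.2.2.2 then z.im else z.re) (((Real.sqrt 2 : ℂ) • ((fundamentalLatticeRep 2).lieProj (noiseDir m.2) * (fun (ee : Edge 3 L) => Matrix.of fun (i j : Fin (fundamentalLatticeRep 2).N) => (((fun (V : GaugeConfig 3 L (Matrix.specialUnitaryGroup (Fin 2) ℂ)) (q : Edge 3 L × Fin (fundamentalLatticeRep 2).N × Fin (fundamentalLatticeRep 2).N × Bool) => (fun z : ℂ => if q.2.2.2 then z.im else z.re) ((fundamentalRep (Fin 2) (V q.1) : Matrix (Fin 2) (Fin 2) ℂ) q.2.1 q.2.2.1)) V (ee, i, j, false) : ℝ) : ℂ) + (((fun (V : GaugeConfig 3 L (Matrix.specialUnitaryGroup (Fin 2) ℂ))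 (q : Edge 3 L × Fin (fundamentalLatticeRep 2).N × Fin (fundamentalLatticeRep 2).N × Bool) => (fun z : ℂ => if q.2.2.2 then z.im else z.re) ((fundamentalRep (Fin 2) (V q.1) : Matrix (Fin 2) (Fin 2) ℂ) q.2.1 q.2.2.1)) V (ee, i, j, true) : ℝ) : ℂ) * Complex.I) q.1)) q.2.1 q.2.2.1) else 0)) *
          fderiv ℝ (fun z : (Edge 3 L × Fin (fundamentalLatticeRep 2).N × Fin (fundamentalLatticeRep 2).N × Bool → ℝ) => fderiv ℝ (fun y : (Edge 3 L × Fin (fundamentalLatticeRep 2).N × Fin (fundamentalLatticeRep 2).N × Bool → ℝ) => (((2 : ℕ) : ℝ) * β) * ∑ p : Plaquette 3 L, (rootedLoop (fun (ee : Edge 3 L) (i j : Fin (fundamentalLatticeRep 2).N) => ((y (ee, i, j, false) : ℝ) : ℂ) + ((y (ee, i, j, true) : ℝ) : ℂ) * Complex.I) (p.1, p.2.1.1) p.2.1.2 false).trace.re) z (fun q : Edge 3 L × Fin (fundamentalLatticeRep 2).N × Fin (fundamentalLatticeRep 2).N × Bool => if m.1 = q.1 then (fun z : ℂ => if q.2.2.2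 then z.im else z.re) (((Real.sqrt 2 : ℂ) • ((fundamentalLatticeRep 2).lieProj (noiseDir m.2) * (fun (ee : Edge 3 L) => Matrix.of fun (i j : Fin (fundamentalLatticeRep 2).N) => ((z (ee, i, j, false) : ℝ) : ℂ) + ((z (ee, i, j, true) : ℝ) : ℂ) * Complex.I) q.1)) q.2.1 q.2.2.1) else 0)) ((fun (V : GaugeConfig 3 L (Matrix.specialUnitaryGroup (Fin 2) ℂ)) (q : Edge 3 L × Fin (fundamentalLatticeRep 2).N × Fin (fundamentalLatticeRep 2).N × Bool) => (fun z : ℂ => if q.2.2.2 then z.im else z.re) ((fundamentalRep (Fin 2) (V q.1) : Matrix (Fin 2) (Fin 2) ℂ) q.2.1 q.2.2.1)) V) (fun q : Edge 3 L × Fin (fundamentalLatticeRep 2).N × Fin (fundamentalLatticeRep 2).N × Bool => if n.1 = q.1 then (fun z : ℂ => if q.2.2.2 then z.im else z.re) (((Real.sqrt 2 : ℂ) • ((fundamentalLatticeRep 2).lieProj (noiseDir n.2) * (fun (ee : Edge 3 L) => Matrix.of fun (i j : Fin (fundamentalLatticeRep 2).N) => (((fun (V : GaugeConfig 3 L (Matrix.specialUnitaryGroup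 (Fin 2) ℂ)) (q : Edge 3 L × Fin (fundamentalLatticeRep 2).N × Fin (fundamentalLatticeRep 2).N × Bool) => (fun z : ℂ => if q.2.2.2 then z.im else z.re) ((fundamentalRep (Fin 2) (V q.1) : Matrix (Fin 2) (Fin 2) ℂ) q.2.1 q.2.2.1)) V (ee, i, j, false) : ℝ) : ℂ) + (((fun (V : GaugeConfig 3 L (Matrix.specialUnitaryGroup (Fin 2) ℂ)) (q : Edge 3 L × Fin (fundamentalLatticeRep 2).N × Fin (fundamentalLatticeRep 2).N × Bool) => (fun z : ℂ => if q.2.2.2 then z.im else z.re) ((fundamentalRep (Fin 2) (V q.1) : Matrix (Fin 2) (Fin 2) ℂ) q.2.1 q.2.2.1)) V (ee, i, j, true) : ℝ) : ℂ) * Complex.I) q.1)) q.2.1 q.2.2.1) else 0)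
        ≤ K₀ * ∑ n : Edge 3 L × NoiseIdx (fundamentalLatticeRep 2).N, (Λ (fun q : Edge 3 L × Fin (fundamentalLatticeRep 2).N × Fin (fundamentalLatticeRep 2).N × Bool => if n.1 = q.1 then (fun z : ℂ => if q.2.2.2 then z.im else z.re) (((Real.sqrt 2 : ℂ) • ((fundamentalLatticeRep 2).lieProj (noiseDir n.2) * (fun (ee : Edge 3 L) => Matrix.of fun (i j : Fin (fundamentalLatticeRep 2).N) => (((fun (V : GaugeConfig 3 L (Matrix.specialUnitaryGroup (Fin 2) ℂ)) (q : Edge 3 L × Fin (fundamentalLatticeRep 2).N × Fin (fundamentalLatticeRep 2).N × Bool) => (fun z : ℂ => if q.2.2.2 then z.im else z.re) ((fundamentalRep (Fin 2) (V q.1) : Matrix (Fin 2) (Fin 2) ℂ) q.2.1 q.2.2.1)) V (ee, i, j, false) : ℝ) : ℂ) + (((fun (V : GaugeConfig 3 L (Matrix.specialUnitaryGroup (Fin 2) ℂ)) (q : Edge 3 L × Fin (fundamentalLatticeRep 2).N × Fin (fundamentalLatticeRep 2).N × Bool) => (fun z : ℂ => if q.2.2.2 then z.im else z.re) ((fundamentalRep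 (Fin 2) (V q.1) : Matrix (Fin 2) (Fin 2) ℂ) q.2.1 q.2.2.1)) V (ee, i, j, true) : ℝ) : ℂ) * Complex.I) q.1)) q.2.1 q.2.2.1) else 0)) ^ 2)) :
    SZZFunctionalInequalitiesWith 3 2 β (1 - K₀ / 2) := by
  intro μ hμ Λ f Lc hf hL hLip
  classical
  obtain ⟨Ls, hLs, hprob, hlim⟩ := hμ
  haveI := hprob
  have hKpos : 0 < 1 - K₀ / 2 := by linarith
  set β' : ℝ := ((2 : ℕ) : ℝ) * β with hβ'
  set S : ℝ := ∑ e : ↥Λ, Lc e ^ 2 with hSdef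
  set F : LGConfig 3 (Matrix.specialUnitaryGroup (Fin 2) ℂ) → ℝ := matrixCylinder Λ f with hF
  -- `F`, `F²`, `F² log F²` are bounded continuous cylinder functions
  have hFcyl : IsCylinder F Λ := isCylinder_matrixCylinder Λ f
  have hFc : Continuous F := by
    refine hf.continuous.comp ?_
    exact continuous_pi fun e => continuous_subtype_val.comp (continuous_apply _)
  have hbdd : ∀ {G : LGConfig 3 (Matrix.specialUnitaryGroup (Fin 2) ℂ) → ℝ}, Continuous G → ∃ C, ∀ U, |G U| ≤ C := by
    intro G hG
    obtain ⟨C, hC⟩ := (isCompact_univ (X := LGConfig 3 (Matrix.specialUnitaryGroup (Fin 2) ℂ))).exists_bound_of_continuousOn hG.continuousOn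
    exact ⟨C, fun U => by simpa [Real.norm_eq_abs] using hC U (Set.mem_univ _)⟩
  obtain ⟨C, hC⟩ := hbdd hFc
  have hF2cyl : IsCylinder (fun U => F U ^ 2) Λ := fun U V hUV => by
    show F U ^ 2 = F V ^ 2
    rw [hFcyl hUV]
  have hF2c : Continuous fun U => F U ^ 2 := hFc.pow 2
  have hF3cyl : IsCylinder (fun U => F U ^ 2 * Real.log (F U ^ 2)) Λ := fun U V hUV => by
    show F U ^ 2 * Real.log (F U ^ 2) = F V ^ 2 * Real.log (F V ^ 2)
    rw [hFcyl hUV]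
  have hF3c : Continuous fun U => F U ^ 2 * Real.log (F U ^ 2) := Real.continuous_mul_log.comp hF2c
  have ht1 := hlim F Λ hFcyl hFc ⟨C, hC⟩
  have ht2 := hlim (fun U => F U ^ 2) Λ hF2cyl hF2c (hbdd hF2c)
  have ht3 := hlim (fun U => F U ^ 2 * Real.log (F U ^ 2)) Λ hF3cyl hF3c (hbdd hF3c)
  -- the variance and the entropy of `μ` as limits of the torus quantities
  have hFm : AEStronglyMeasurable F μ := hFc.aestronglyMeasurable
  have hmem : MemLp F 2 μ := MemLp.of_bound hFm C (ae_of_all _ fun U => by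
    rw [Real.norm_eq_abs]; exact hC U)
  have hvarμ : Var[F; μ] = (∫ U, F U ^ 2 ∂μ) - (∫ U, F U ∂μ) ^ 2 := by
    rw [variance_eq_sub hmem]
    rfl
  have htv : Tendsto (fun k => wilsonExpectation (L := Ls k + 1) (fundamentalRep (Fin 2)) β'
        (toTorusObservable (Ls k + 1) fun U => F U ^ 2) -
      wilsonExpectation (L := Ls k + 1) (fundamentalRep (Fin 2)) β' (toTorusObservable (Ls k + 1) F) ^ 2)
      atTop (𝓝 (Var[F; μ])) := by
    rw [hvarμ]
    exact ht2.sub (ht1.pow 2)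
  have hte : Tendsto (fun k => wilsonExpectation (L := Ls k + 1) (fundamentalRep (Fin 2)) β'
        (toTorusObservable (Ls k + 1) fun U => F U ^ 2 * Real.log (F U ^ 2)) -
      wilsonExpectation (L := Ls k + 1) (fundamentalRep (Fin 2)) β' (toTorusObservable (Ls k + 1) fun U => F U ^ 2) *
        Real.log (wilsonExpectation (L := Ls k + 1) (fundamentalRep (Fin 2)) β' (toTorusObservable (Ls k + 1) fun U => F U ^ 2)))
      atTop (𝓝 ((∫ U, F U ^ 2 * Real.log (F U ^ 2) ∂μ) - (∫ U, F U ^ 2 ∂μ) * Real.log (∫ U, F U ^ 2 ∂μ))) :=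
    ht3.sub ((Real.continuous_mul_log.tendsto _).comp ht2)
  -- on every torus large enough, both torus inequalities hold with the constant `Σ_e L_e²`
  have hev : ∀ᶠ k : ℕ in atTop,
      (wilsonExpectation (L := Ls k + 1) (fundamentalRep (Fin 2)) β'
          (toTorusObservable (Ls k + 1) fun U => F U ^ 2 * Real.log (F U ^ 2)) -
        wilsonExpectation (L := Ls k + 1) (fundamentalRep (Fin 2)) β' (toTorusObservable (Ls k + 1) fun U => F U ^ 2) *
          Real.log (wilsonExpectation (L := Ls k + 1) (fundamentalRep (Fin 2)) β' (toTorusObservable (Ls k + 1) fun U => F U ^ 2))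
        ≤ 2 * S / (1 - K₀ / 2)) ∧
      (wilsonExpectation (L := Ls k + 1) (fundamentalRep (Fin 2)) β'
          (toTorusObservable (Ls k + 1) fun U => F U ^ 2) -
        wilsonExpectation (L := Ls k + 1) (fundamentalRep (Fin 2)) β' (toTorusObservable (Ls k + 1) F) ^ 2
        ≤ S / (1 - K₀ / 2)) := by
    have hinj : ∀ᶠ k : ℕ in atTop, Set.InjOn (torusEdge (d := 3) (Ls k + 1)) ↑Λ := by
      have h1 := eventually_injOn_torusEdge' (d := 3) Λ
      have h2 : Tendsto (fun k => Ls k + 1) atTop atTop :=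
        tendsto_atTop_mono (fun k => Nat.le_succ (Ls k)) hLs.tendsto_atTop
      exact h2.eventually h1
    refine hinj.mono fun k hk => ?_
    set L : ℕ := Ls k + 1 with hL'
    set μ' : Measure (GaugeConfig 3 L (Matrix.specialUnitaryGroup (Fin 2) ℂ)) := (wilsonMeasure (d := 3) (L := L) (fundamentalRep (Fin 2)) β') with hμ'
    haveI : IsProbabilityMeasure μ' :=
      isProbabilityMeasure_wilsonMeasure (d := 3) (L := L) (fundamentalRep (Fin 2)) (continuous_fundamentalRep (Fin 2)) β'
    -- the cylinder function on the torus as a function of the real link coordinates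
    set g : (Edge 3 L × Fin 2 × Fin 2 × Bool → ℝ) → ℝ := fun y => f (fun e : ↥Λ => (fun (ee : Edge 3 L) => Matrix.of fun (i j : Fin (fundamentalLatticeRep 2).N) => ((y (ee, i, j, false) : ℝ) : ℂ) + ((y (ee, i, j, true) : ℝ) : ℂ) * Complex.I) (torusEdge L e.1)) with hg
    -- `g` is smooth: `f` composed with a linear map
    set Ψ : (Edge 3 L × Fin 2 × Fin 2 × Bool → ℝ) → (↥Λ → Matrix (Fin 2) (Fin 2) ℂ) := fun y e => (fun (ee : Edge 3 L) => Matrix.of fun (i j : Fin (fundamentalLatticeRep 2).N) => ((y (ee, i, j, false) : ℝ) : ℂ) + ((y (ee, i, j, true) : ℝ) : ℂ) * Complex.I) (torusEdge L e.1) with hΨ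
    have hΨadd : ∀ y y', Ψ (y + y') = Ψ y + Ψ y' := by
      intro y y'; funext e; ext i j
      show (((y + y') (torusEdge L e.1, i, j, false) : ℝ) : ℂ) + (((y + y') (torusEdge L e.1, i, j, true) : ℝ) : ℂ) * Complex.I =
        ((((y (torusEdge L e.1, i, j, false) : ℝ) : ℂ) + ((y (torusEdge L e.1, i, j, true) : ℝ) : ℂ) * Complex.I) +
          (((y' (torusEdge L e.1, i, j, false) : ℝ) : ℂ) + ((y' (torusEdge L e.1, i, j, true) : ℝ) : ℂ) * Complex.I))
      simp only [Pi.add_apply]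
      push_cast; ring
    have hΨsmul : ∀ (a : ℝ) y, Ψ (a • y) = a • Ψ y := by
      intro a y; funext e; ext i j
      show (((a • y) (torusEdge L e.1, i, j, false) : ℝ) : ℂ) + (((a • y) (torusEdge L e.1, i, j, true) : ℝ) : ℂ) * Complex.I =
        a • ((((y (torusEdge L e.1, i, j, false) : ℝ) : ℂ) + ((y (torusEdge L e.1, i, j, true) : ℝ) : ℂ) * Complex.I))
      simp only [Pi.smul_apply, smul_eq_mul, Complex.real_smul]
      push_cast; ring
    let Ψl : (Edge 3 L × Fin 2 × Fin 2 × Bool → ℝ) →ₗ[ℝ] (↥Λ → Matrix (Fin 2) (Fin 2) ℂ) := { toFun := Ψ, map_add' := hΨadd, map_smul' := hΨsmul }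
    let Ψc : (Edge 3 L × Fin 2 × Fin 2 × Bool → ℝ) →L[ℝ] (↥Λ → Matrix (Fin 2) (Fin 2) ℂ) := LinearMap.toContinuousLinearMap Ψl
    have hΨc : ∀ y, Ψc y = Ψ y := fun y => rfl
    have hgΨ : g = f ∘ Ψc := by funext y; rfl
    have hgc' : ContDiff ℝ ∞ g := by
      rw [hgΨ]
      exact hf.comp Ψc.contDiff
    have hgc : ContDiff ℝ 3 g := by exact_mod_cast (contDiff_infty.1 hgc' 3)
    -- `g ∘ coords = F ∘ torusLift`
    have hgco : ∀ y : (GaugeConfig 3 L (Matrix.specialUnitaryGroup (Fin 2) ℂ)), g ((fun (V : GaugeConfig 3 L (Matrix.specialUnitaryGroup (Fin 2) ℂ)) (q : Edge 3 L × Fin (fundamentalLatticeRep 2).N × Fin (fundamentalLatticeRep 2).N × Bool) => (fun z : ℂ => if q.2.2.2 then z.im else z.re) ((fundamentalRep (Fin 2) (V q.1) : Matrix (Fin 2) (Fin 2) ℂ) q.2.1 q.2.2.1)) y) = F (torusLift L y) := by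
      intro y
      show f _ = f _
      congr 1
      funext e
      exact congrFun (rebuild_coords_of (L := L) y) (torusEdge L e.1)
    -- its link-Lipschitz profile on the torus
    set ℓ : Edge 3 L → ℝ := fun e' => ∑ e : ↥Λ, if torusEdge L e.1 = e' then Lc e else 0 with hℓ
    have hℓ0 : ∀ e', 0 ≤ ℓ e' := fun e' => Finset.sum_nonneg fun e _ => by
      split_ifs
      · exact hL e
      · exact le_rfl
    have hLipg : ∀ (e' : Edge 3 L) (y y' : (GaugeConfig 3 L (Matrix.specialUnitaryGroup (Fin 2) ℂ))), (∀ e'', e'' ≠ e' → y e'' = y' e'') →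
        |g ((fun (V : GaugeConfig 3 L (Matrix.specialUnitaryGroup (Fin 2) ℂ)) (q : Edge 3 L × Fin (fundamentalLatticeRep 2).N × Fin (fundamentalLatticeRep 2).N × Bool) => (fun z : ℂ => if q.2.2.2 then z.im else z.re) ((fundamentalRep (Fin 2) (V q.1) : Matrix (Fin 2) (Fin 2) ℂ) q.2.1 q.2.2.1)) y) - g ((fun (V : GaugeConfig 3 L (Matrix.specialUnitaryGroup (Fin 2) ℂ)) (q : Edge 3 L × Fin (fundamentalLatticeRep 2).N × Fin (fundamentalLatticeRep 2).N × Bool) => (fun z : ℂ => if q.2.2.2 then z.im else z.re) ((fundamentalRep (Fin 2) (V q.1) : Matrix (Fin 2) (Fin 2) ℂ) q.2.1 q.2.2.1)) y')| ≤ ℓ e' * frobNorm ((y e' : Matrix (Fin 2) (Fin 2) ℂ) - (y' e' : Matrix (Fin 2) (Fin 2) ℂ)) := by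
      intro e' y y' hyy
      rw [hgco y, hgco y']
      by_cases hex : ∃ e₀ : ↥Λ, torusEdge L e₀.1 = e'
      · obtain ⟨e₀, he₀⟩ := hex
        have huniq : ∀ e : ↥Λ, e ≠ e₀ → torusEdge L e.1 ≠ e' := by
          intro e hne hEq
          exact hne (Subtype.ext (hk e.2 e₀.2 (hEq.trans he₀.symm)))
        have hℓ' : ℓ e' = Lc e₀ := by
          simp only [hℓ]
          rw [Finset.sum_eq_single e₀]
          · rw [if_pos he₀]
          · intro e _ hne; rw [if_neg (huniq e hne)]
          · intro h; exact absurd (Finset.mem_univ _) h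
        have hdiff := hLip e₀ (fun e => torusLift L y e.1) (fun e => torusLift L y' e.1)
          (fun e hne => by
            show y (torusEdge L e.1) = y' (torusEdge L e.1)
            exact hyy _ (huniq e hne))
        have hy0 : torusLift L y e₀.1 = y e' := by
          show y (torusEdge L e₀.1) = y e'; rw [he₀]
        have hy0' : torusLift L y' e₀.1 = y' e' := by
          show y' (torusEdge L e₀.1) = y' e'; rw [he₀]
        rw [hy0, hy0'] at hdiff
        rw [hℓ']
        exact hdiff
      · push Not at hex
        have hsame : (fun e : ↥Λ => ((torusLift L y e.1 : Matrix.specialUnitaryGroup (Fin 2) ℂ) : Matrix (Fin 2) (Fin 2) ℂ)) =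
            fun e : ↥Λ => ((torusLift L y' e.1 : Matrix.specialUnitaryGroup (Fin 2) ℂ) : Matrix (Fin 2) (Fin 2) ℂ) := by
          funext e
          have h1 : torusLift L y e.1 = torusLift L y' e.1 := by
            show y (torusEdge L e.1) = y' (torusEdge L e.1)
            exact hyy _ (hex e)
          rw [h1]
        have h0 : F (torusLift L y) - F (torusLift L y') = 0 := by
          simp only [hF, matrixCylinder_apply]
          rw [hsame, sub_self]
        rw [h0, abs_zero]
        exact mul_nonneg (hℓ0 e') (frobNorm_nonneg _)
    -- `∑_{e'} ℓ_{e'}² = ∑_e L_e²` by injectivity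
    have hsumℓ : ∑ e', ℓ e' ^ 2 = S := by
      have hsq : ∀ e', ℓ e' ^ 2 = ∑ e : ↥Λ, if torusEdge L e.1 = e' then Lc e ^ 2 else 0 := by
        intro e'
        by_cases hex : ∃ e₀ : ↥Λ, torusEdge L e₀.1 = e'
        · obtain ⟨e₀, he₀⟩ := hex
          have huniq : ∀ e : ↥Λ, e ≠ e₀ → torusEdge L e.1 ≠ e' := by
            intro e hne hEq
            exact hne (Subtype.ext (hk e.2 e₀.2 (hEq.trans he₀.symm)))
          simp only [hℓ]
          rw [Finset.sum_eq_single e₀, Finset.sum_eq_single e₀, if_pos he₀, if_pos he₀]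
          · intro e _ hne; rw [if_neg (huniq e hne)]
          · intro h; exact absurd (Finset.mem_univ _) h
          · intro e _ hne; rw [if_neg (huniq e hne)]
          · intro h; exact absurd (Finset.mem_univ _) h
        · push Not at hex
          simp only [hℓ]
          rw [Finset.sum_eq_zero fun e _ => if_neg (hex e), Finset.sum_eq_zero fun e _ => if_neg (hex e)]
          ring
      simp_rw [hsq]
      rw [Finset.sum_comm]
      refine Finset.sum_congr rfl fun e _ => ?_
      rw [Finset.sum_ite_eq Finset.univ (torusEdge L e.1) (fun _ => Lc e ^ 2)]
      simp
    -- the torus inequalities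
    have hTv : ∫ V, (g ((fun (V : GaugeConfig 3 L (Matrix.specialUnitaryGroup (Fin 2) ℂ)) (q : Edge 3 L × Fin (fundamentalLatticeRep 2).N × Fin (fundamentalLatticeRep 2).N × Bool) => (fun z : ℂ => if q.2.2.2 then z.im else z.re) ((fundamentalRep (Fin 2) (V q.1) : Matrix (Fin 2) (Fin 2) ℂ) q.2.1 q.2.2.1)) V) - ∫ V', g ((fun (V : GaugeConfig 3 L (Matrix.specialUnitaryGroup (Fin 2) ℂ)) (q : Edge 3 L × Fin (fundamentalLatticeRep 2).N × Fin (fundamentalLatticeRep 2).N × Bool) => (fun z : ℂ => if q.2.2.2 then z.im else z.re) ((fundamentalRep (Fin 2) (V q.1) : Matrix (Fin 2) (Fin 2) ℂ) q.2.1 q.2.2.1)) V') ∂μ') ^ 2 ∂μ' ≤ (∑ e' : Edge 3 L, ℓ e' ^ 2) / (1 - K₀ / 2) :=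
      wilson_variance_le_of_hessBound_of_linkLipschitz L β' K₀ hK (hHess L) g hgc hℓ0 hLipg
    have hTe : (∫ V, g ((fun (V : GaugeConfig 3 L (Matrix.specialUnitaryGroup (Fin 2) ℂ)) (q : Edge 3 L × Fin (fundamentalLatticeRep 2).N × Fin (fundamentalLatticeRep 2).N × Bool) => (fun z : ℂ => if q.2.2.2 then z.im else z.re) ((fundamentalRep (Fin 2) (V q.1) : Matrix (Fin 2) (Fin 2) ℂ) q.2.1 q.2.2.1)) V) ^ 2 * Real.log (g ((fun (V : GaugeConfig 3 L (Matrix.specialUnitaryGroup (Fin 2) ℂ)) (q : Edge 3 L × Fin (fundamentalLatticeRep 2).N × Fin (fundamentalLatticeRep 2).N × Bool) => (fun z : ℂ => if q.2.2.2 then z.im else z.re) ((fundamentalRep (Fin 2) (V q.1) : Matrix (Fin 2) (Fin 2) ℂ) q.2.1 q.2.2.1)) V) ^ 2) ∂μ') -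
        (∫ V, g ((fun (V : GaugeConfig 3 L (Matrix.specialUnitaryGroup (Fin 2) ℂ)) (q : Edge 3 L × Fin (fundamentalLatticeRep 2).N × Fin (fundamentalLatticeRep 2).N × Bool) => (fun z : ℂ => if q.2.2.2 then z.im else z.re) ((fundamentalRep (Fin 2) (V q.1) : Matrix (Fin 2) (Fin 2) ℂ) q.2.1 q.2.2.1)) V) ^ 2 ∂μ') * Real.log (∫ V, g ((fun (V : GaugeConfig 3 L (Matrix.specialUnitaryGroup (Fin 2) ℂ)) (q : Edge 3 L × Fin (fundamentalLatticeRep 2).N × Fin (fundamentalLatticeRep 2).N × Bool) => (fun z : ℂ => if q.2.2.2 then z.im else z.re) ((fundamentalRep (Fin 2) (V q.1) : Matrix (Fin 2) (Fin 2) ℂ) q.2.1 q.2.2.1)) V) ^ 2 ∂μ') ≤ 2 * (∑ e' : Edge 3 L, ℓ e' ^ 2) / (1 - K₀ / 2) :=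
      wilson_entropy_le_of_hessBound_of_linkLipschitz L β' K₀ hK (hHess L) g hgc hℓ0 hLipg
    simp only [hgco, hsumℓ] at hTv hTe
    -- identify the torus quantities with the Wilson expectations of `F ∘ torusLift`
    have hFLc : Continuous fun V : (GaugeConfig 3 L (Matrix.specialUnitaryGroup (Fin 2) ℂ)) => F (torusLift L V) :=
      hFc.comp (continuous_pi fun e => continuous_apply (torusEdge L e))
    have hmemk : MemLp (fun V : (GaugeConfig 3 L (Matrix.specialUnitaryGroup (Fin 2) ℂ)) => F (torusLift L V)) 2 μ' :=
      MemLp.of_bound hFLc.aestronglyMeasurable C (ae_of_all _ fun V => by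
        rw [Real.norm_eq_abs]; exact hC (torusLift L V))
    have hv1 : Var[fun V : (GaugeConfig 3 L (Matrix.specialUnitaryGroup (Fin 2) ℂ)) => F (torusLift L V); μ'] =
        ∫ V, (F (torusLift L V) - ∫ V', F (torusLift L V') ∂μ') ^ 2 ∂μ' :=
      variance_eq_integral hFLc.measurable.aemeasurable
    have hv2 : Var[fun V : (GaugeConfig 3 L (Matrix.specialUnitaryGroup (Fin 2) ℂ)) => F (torusLift L V); μ'] =
        wilsonExpectation (L := L) (fundamentalRep (Fin 2)) β' (toTorusObservable L fun U => F U ^ 2) -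
          wilsonExpectation (L := L) (fundamentalRep (Fin 2)) β' (toTorusObservable L F) ^ 2 := by
      rw [variance_eq_sub hmemk]
      rfl
    refine ⟨?_, ?_⟩
    · exact hTe
    · rw [← hv2, hv1]
      exact hTv
  -- pass to the limit
  have hev1 := hev.mono fun k hk => hk.1
  have hev2 := hev.mono fun k hk => hk.2
  have hE := le_of_tendsto hte hev1
  have hV := le_of_tendsto htv hev2
  refine ⟨?_, ?_⟩
  · calc (∫ U, matrixCylinder Λ f U ^ 2 * Real.log (matrixCylinder Λ f U ^ 2) ∂μ) -
          (∫ U, matrixCylinder Λ f U ^ 2 ∂μ) * Real.log (∫ U, matrixCylinder Λ f U ^ 2 ∂μ)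
        ≤ 2 * S / (1 - K₀ / 2) := hE
      _ = 2 / (1 - K₀ / 2) * ∑ e, Lc e ^ 2 := by rw [hSdef]; ring
  · calc Var[matrixCylinder Λ f; μ] ≤ S / (1 - K₀ / 2) := hV
      _ = 1 / (1 - K₀ / 2) * ∑ e, Lc e ^ 2 := by rw [hSdef]; ring

/-! ## §3. The sharp window `|β| < 1/24` and Shen–Zhu–Zhu's Theorem 1.4 for `SU(2)`, `d = 3` -/

/-- ★★★ **Shen–Zhu–Zhu's Corollary 4.5 (both clauses) for `SU(2)`, `d = 3`, in the sharp window `|β| < 1/24`.**  For every 't Hooft coupling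
`|β| < 1/24`, every infinite-volume limit point of the torus `SU(2)` Wilson states at tree coupling `2β` satisfies the log-Sobolev and Poincaré
inequalities of Shen–Zhu–Zhu's Theorem 1.4 in Lipschitz form with the constant `K = 1 − 24|β|` (`= N/2 − 4dN|β|`, the venture `YMGap`'s
kernel Hessian count; the printed `K_S = N/2 − 8(d−1)N|β| = 1 − 32|β|`): `SZZFunctionalInequalitiesWith 3 2 β (1 − 24|β|)` — from the tree's
Hessian bound `wilson_hessBound` (`K₀ = 24|β'|`, `β' = 2β`). [cite: ShenZhuZhu2022, Theorem 1.4 (1.9)–(1.10) and §4 Corollary 4.5] -/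
theorem szzFunctionalInequalitiesWith_su2_sharp (β : ℝ) (hβ : |β| < 1 / 24) :
    SZZFunctionalInequalitiesWith 3 2 β (1 - 24 * |β|) := by
  have h2 : |((2 : ℕ) : ℝ) * β| = 2 * |β| := by
    rw [abs_mul, Nat.cast_ofNat, abs_of_pos (by norm_num : (0 : ℝ) < 2)]
  have hK : 24 * |((2 : ℕ) : ℝ) * β| < 2 := by rw [h2]; linarith
  have h := szzFunctionalInequalitiesWith_su2_of_hessBound β (24 * |((2 : ℕ) : ℝ) * β|) hK
    (fun L _ => wilson_hessBound L (((2 : ℕ) : ℝ) * β))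
  have e : 1 - 24 * |((2 : ℕ) : ℝ) * β| / 2 = 1 - 24 * |β| := by rw [h2]; ring
  rw [e] at h
  exact h

/-- ★★★ **THE NAMED FACT `shenZhuZhu_functionalInequalities 3 2` IS A THEOREM: Shen–Zhu–Zhu's Theorem 1.4 = Corollary 4.5 for `SU(2)`
lattice Yang–Mills in three dimensions.**  For every 't Hooft coupling `|β| < 1/32` (Assumption 1.1, `K_S = 1 − 32|β| > 0`) and every
infinite-volume limit point `μ` of the torus `SU(2)` Wilson states at tree coupling `2β`: for every smooth cylinder function `F = f((U_e)_(e∈Λ))`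
that is `L_e`-Lipschitz in the link `e` (Frobenius distance), `Ent_μ(F²) ≤ (2/K_S)Σ_e L_e²` and `Var_μ(F) ≤ (1/K_S)Σ_e L_e²` — unconditionally,
from the fixed-cut-off Bakry–Émery package of this route (`szzFunctionalInequalitiesWith_su2_sharp` and `1/K_S ≥ 1/(1 − 24|β|)`).
HONEST FRAMING: strong coupling, fixed lattice; not a continuum or mass-gap statement. [cite: ShenZhuZhu2022, Theorem 1.4 (1.9)–(1.10) and §4 Corollary 4.5 (4.12)–(4.13)] -/
theorem shenZhuZhu_functionalInequalities_su2_d3 : shenZhuZhu_functionalInequalities 3 2 := by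
  intro hd hN β hβ
  have hKS : 0 < szzBakryEmeryConstSU 2 3 β := (szzBakryEmeryConstSU_pos_iff hd hN β).2 hβ
  have hKSeq : szzBakryEmeryConstSU 2 3 β = 1 - 32 * |β| := by
    rw [szzBakryEmeryConstSU_eq]; norm_num; ring
  have hβ' : |β| < 1 / 24 := by rw [hKSeq] at hKS; linarith
  refine SZZFunctionalInequalitiesWith.mono_const (szzFunctionalInequalitiesWith_su2_sharp β hβ') hKS ?_
  rw [hKSeq]
  linarith [abs_nonneg β]

end Summit.QuantumFields.YangMills.Theorems.ColdStartUniversality
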